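/-
Copyright (c) 2026 the pub-hodgecm-mathlib formalisation cell (harness21).  Prover seat hodgecm-mathlib-K2E4-p11 (g9): Track B «K2-LIT»,
hLiu418 = stmt-HodgeConjecture-24832, socket #41 KIND W, organ «Φ6b-ind» (J3) (LEAD F0P6-plan (g14) BATCH #178 (1); KW desk K2E3-p11 (g10)):
ANALYTIC CONTINUATION OF THE `h`-LINE JETS OF SHIMURA's ξ ON `Herm₂(ℂ)` AT EVERY NON-DEGENERATE INDEX, the residual letter `hJet` of the
«Φ6b-ind» consumer head PAID BY NAME, and the UNCONDITIONAL indefinite head.  THEOREMS ONLY (no `def`, no `instance`, no `notation`, no `sorry`).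
-/
import Summits.HodgeConjecture.HodgeConjecture.Theorems.K2LiuHermTwoXiMomentHolomorphy          -- ★ (J1) (this seat): holomorphy of the moments in `s`
import Summits.HodgeConjecture.HodgeConjecture.Theorems.K2LiuHermTwoXiMomentRecursion           -- ★ (J2) (this seat): the moment recursion, solved
import Summits.HodgeConjecture.HodgeConjecture.Theorems.K2LiuKindWArchIndefiniteLetter          -- ★ the «Φ6b-ind» consumer head (hypothesis-first on `hJet`)
import HarnessLib

/-!
# Crux `HLiu418`, ROAD Φ ∕ KIND W organ «Φ6b-ind», (J3): continuation of the `h`-line jets of ξ; `hJet` BY NAME; the unconditional indefinite head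

Cell `hodgecm-mathlib`, crux item hLiu418 = `stmt-HodgeConjecture-24832` (helper lane `--supports … --as helper`, count-neutral), route of record
`HCCMUnconditional`; squad K2 ∕ K2Liu, road `K2_Liu`, socket #41, KIND W.  Third of the three files paying the jet-continuation letter `hJet` of ★
`K2LiuKindWArchIndefiniteLetter`.

WHAT.  `M_e(h; α, β) = ∫ (−2πi·tr(Θx))^e·ξ-integrand(1, h; α, β)(x) dx` (the `e`-th real `h`-line jet of ξ, ★ `iteratedDeriv_xiTwo_hLine`).  For hermitian
`h` with `det h ≠ 0` (ANY signature) and hermitian `Θ`: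
* `exists_continuation_traceMoment` — for every `N e a b` there is `F` HOLOMORPHIC on `{s | 3 + e − N < re(a + b + 2s)}` with `F s = M_e(h; a + s, b + s)` on
  the half-plane of absolute convergence `{3 + e < re(a + b + 2s)}`.  Induction on `N` for all `(e, a, b)` at once: base ★ (J1) `differentiableOn_traceMoment`;
  step by ★ (J2) `traceMoment_eq_of_det_ne_zero` — `M_e(α, β)` is a holomorphic combination of `M_e` at `α + β` raised by `1, 2` and of the LOWER moments
  `M_{e−1}, M_{e−2}` at `(α, β)`, all continued one unit further left by the induction hypothesis;
* **`hJet_holds`** — THE RESIDUAL LETTER `hJet` OF THE CONSUMER HEAD, BY NAME: `∀ h Θ, hᴴ = h → h.det.re < 0 → Θᴴ = Θ → ∀ e a b, ∃ F s₀, DifferentiableOn ℂ F {0 < re} ∧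
  ∀ s, s₀ < re s → F s = iteratedDeriv e (fun t : ℝ => xiTwo 1 (h + t•Θ) (a + s) (b + s)) 0`;
* **`exists_twistedWhittaker_continuation_of_indef'`** — the `hInd` telescope of ★ `hW_of_signCases` with NO residual letter (★ head fed `hJet_holds`), and
  **`hW_of_signCases'`** — ★ `hW_of_signCases` with its `hInd` slot DISCHARGED: the per-place archimedean Whittaker letter `hW` at every non-degenerate framed
  index (definite or indefinite) from the window `hk`, the frame ∕ index readings and the holomorphy letter `hWhol` alone.
This closes the CONTINUATION organ «Φ6b-ind» for the letter `hW` ([Shimura1982, Thm. 4.2, continuation half] at `n = 2`, every signature, on the ξ-side).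
What is NOT here (honest): the GROWTH face at an indefinite index ((R3), decay in `h` ∕ polynomial growth in `im s` — Shimura §4), OPEN.
[Shimura1982, §3 Thm. 3.1, §4 Thm. 4.2] [Shimura1997, §16.4–16.5, §18.4].
HONEST LABEL.  Count-neutral helper of the K2_Liu road; it pays no socket by itself: `HC_CM` is proved only modulo the 7 printed citations
(2 remaining named inputs: hLiu418 = `stmt-HodgeConjecture-24832`, h413 = `stmt-HodgeConjecture-24833`) until rung 0 closes.

## References
* [Shimura1982] G. Shimura, *Confluent hypergeometric functions on tube domains*, Math. Ann. 260 (1982) 269–302: §3 Thm. 3.1, §4 Thm. 4.2.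
* [Shimura1997] G. Shimura, *Euler Products and Eisenstein Series*, CBMS 93 (1997): §16.4–16.5, §18.4.
-/

set_option autoImplicit false
-- the mandated namespace repeats the single-problem summit's segment (`HodgeConjecture.HodgeConjecture`)
set_option linter.dupNamespace false

noncomputable section

open scoped Matrix ComplexConjugate ComplexOrder
open Complex Matrix MeasureTheory Set
open Literature.NumberTheory.ModularForms.SiegelUpperHalfSpace (moeb)

namespace Summit.HodgeConjecture.HodgeConjecture.Cruxes.HLiu418.K2LiuHermTwoXiJetContinuation

open Summit.HodgeConjecture.HodgeConjecture.Cruxes.HLiu418.K2LiuHermTwoGammaDefs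
open Summit.HodgeConjecture.HodgeConjecture.Cruxes.HLiu418.K2LiuHermTwoConfluentXiDefs
open Summit.HodgeConjecture.HodgeConjecture.Cruxes.HLiu418.K2LiuXiTwoMomentsAsHDerivatives (iteratedDeriv_xiTwo_hLine)
open Summit.HodgeConjecture.HodgeConjecture.Cruxes.HLiu418.K2LiuHermTwoXiMomentHolomorphy (differentiableOn_traceMoment)
open Summit.HodgeConjecture.HodgeConjecture.Cruxes.HLiu418.K2LiuHermTwoXiMomentRecursion (traceMoment_eq_of_det_ne_zero)
open Summit.HodgeConjecture.HodgeConjecture.Cruxes.HLiu418.K2LiuArchInducedTubeDefs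
open Summit.HodgeConjecture.HodgeConjecture.Cruxes.HLiu418.K2LiuU22CompactPictureDefs
open Summit.HodgeConjecture.HodgeConjecture.Cruxes.HLiu418.K2LiuKindWArchIndefiniteLetter (exists_twistedWhittaker_continuation_of_indef)
open Summit.HodgeConjecture.HodgeConjecture.Cruxes.HLiu418.K2LiuKindWArchWhittakerLetterDispatch (hW_of_signCases)

/-! ## §1 Continuation of the trace moments `s ↦ M_e(h; a + s, b + s)` -/

/-- **ANALYTIC CONTINUATION OF THE `h`-LINE JETS OF ξ AT EVERY NON-DEGENERATE INDEX** (organ «Φ6b-ind» (J3)): for hermitian `h` with `det h ≠ 0`,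
hermitian `Θ`, and every `N e : ℕ`, `a b : ℂ`, there is `F : ℂ → ℂ` HOLOMORPHIC on `{s | 3 + e − N < re(a + b + 2s)}` with
`F s = ∫ (−2πi·tr(Θx))^e·ξ-integrand(1, h; a + s, b + s)(x) dx` on `{3 + e < re(a + b + 2s)}`.  Induction on `N` (all `e, a, b` at once): base ★ (J1); step ★ (J2)
`traceMoment_eq_of_det_ne_zero`, the lower moments being continued by the same induction hypothesis. [cite: Shimura1982, §3 Thm. 3.1, §4 Thm. 4.2] -/
theorem exists_continuation_traceMoment {h Θ : Matrix (Fin 2) (Fin 2) ℂ} (hh : h.IsHermitian) (hdet : h.det ≠ 0) (hΘ : Θ.IsHermitian) (N : ℕ) :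
    ∀ (e : ℕ) (a b : ℂ), ∃ F : ℂ → ℂ, DifferentiableOn ℂ F {s : ℂ | 3 + (e : ℝ) - N < (a + b + 2 * s).re} ∧
      ∀ s : ℂ, 3 + (e : ℝ) < (a + b + 2 * s).re →
        F s = ∫ c : ℝ × ℂ × ℝ, (-(2 * Real.pi * I) * (Θ * hermTwo c).trace) ^ e * xiTwoIntegrand 1 h (a + s) (b + s) c := by
  induction N with
  | zero =>
    intro e a b
    refine ⟨fun s => ∫ c : ℝ × ℂ × ℝ, (-(2 * Real.pi * I) * (Θ * hermTwo c).trace) ^ e * xiTwoIntegrand 1 h (a + s) (b + s) c, ?_, fun s _ => rfl⟩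
    simp only [Nat.cast_zero, sub_zero]
    exact differentiableOn_traceMoment hh Θ e a b
  | succ N ih =>
    intro e a b
    -- the three shifted continuations of order `e`
    obtain ⟨F₁, hF₁d, hF₁⟩ := ih e (a + 1) b
    obtain ⟨F₂, hF₂d, hF₂⟩ := ih e a (b + 1)
    obtain ⟨F₃, hF₃d, hF₃⟩ := ih e (a + 1) (b + 1)
    have hsub1 : {s : ℂ | 3 + (e : ℝ) - ((N + 1 : ℕ) : ℝ) < (a + b + 2 * s).re} ⊆ {s : ℂ | 3 + (e : ℝ) - (N : ℝ) < (a + 1 + b + 2 * s).re} := fun s hs => by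
      simp only [mem_setOf_eq, add_re, one_re, Nat.cast_add, Nat.cast_one] at hs ⊢
      linarith
    have hsub2 : {s : ℂ | 3 + (e : ℝ) - ((N + 1 : ℕ) : ℝ) < (a + b + 2 * s).re} ⊆ {s : ℂ | 3 + (e : ℝ) - (N : ℝ) < (a + (b + 1) + 2 * s).re} := fun s hs => by
      simp only [mem_setOf_eq, add_re, one_re, Nat.cast_add, Nat.cast_one] at hs ⊢
      linarith
    have hsub3 : {s : ℂ | 3 + (e : ℝ) - ((N + 1 : ℕ) : ℝ) < (a + b + 2 * s).re} ⊆ {s : ℂ | 3 + (e : ℝ) - (N : ℝ) < (a + 1 + (b + 1) + 2 * s).re} := fun s hs => by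
      simp only [mem_setOf_eq, add_re, one_re, Nat.cast_add, Nat.cast_one] at hs ⊢
      linarith
    have hla : Differentiable ℂ (fun s : ℂ => a + s) := differentiable_id.const_add a
    have hlb : Differentiable ℂ (fun s : ℂ => b + s) := differentiable_id.const_add b
    have hl1 : Differentiable ℂ (fun s : ℂ => a + s + (b + s) - 1) := (hla.add hlb).sub_const 1
    have hq : Differentiable ℂ (fun s : ℂ => 4 * (a + s) * (b + s)) := ((differentiable_const _).mul hla).mul hlb
    -- the main (order-`e`) part of the solved recursion, continued
    have hmain : DifferentiableOn ℂ (fun s : ℂ => (-(4 * (Real.pi : ℂ) ^ 2) * h.det)⁻¹ *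
        ((a + s + (b + s) - 1) * ((a + s) * F₁ s + (b + s) * F₂ s) + 4 * (a + s) * (b + s) * F₃ s))
        {s : ℂ | 3 + (e : ℝ) - ((N + 1 : ℕ) : ℝ) < (a + b + 2 * s).re} :=
      (differentiableOn_const _).mul (((hl1.differentiableOn).mul (((hla.differentiableOn).mul (hF₁d.mono hsub1)).add
        ((hlb.differentiableOn).mul (hF₂d.mono hsub2)))).add ((hq.differentiableOn).mul (hF₃d.mono hsub3)))
    -- side conditions on the half-plane of convergence
    have hconv : ∀ s : ℂ, 3 + (e : ℝ) < (a + b + 2 * s).re →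
        3 + (e : ℝ) < (a + 1 + b + 2 * s).re ∧ 3 + (e : ℝ) < (a + (b + 1) + 2 * s).re ∧ 3 + (e : ℝ) < (a + 1 + (b + 1) + 2 * s).re ∧
          3 + (e : ℝ) < (a + s + (b + s)).re := fun s hs => by
      simp only [add_re, one_re, mul_re, re_ofNat, im_ofNat, zero_mul, sub_zero] at hs ⊢
      refine ⟨by linarith, by linarith, by linarith, by linarith⟩
    have e1 : ∀ s : ℂ, a + 1 + s = a + s + 1 := fun s => by ring
    have e2 : ∀ s : ℂ, b + 1 + s = b + s + 1 := fun s => by ring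
    rcases e with _ | e
    · -- order 0: no lower moments
      refine ⟨fun s => (-(4 * (Real.pi : ℂ) ^ 2) * h.det)⁻¹ *
          ((a + s + (b + s) - 1) * ((a + s) * F₁ s + (b + s) * F₂ s) + 4 * (a + s) * (b + s) * F₃ s), hmain, fun s hs => ?_⟩
      obtain ⟨hs1, hs2, hs3, hαβ⟩ := hconv s hs
      simp only
      rw [hF₁ s hs1, hF₂ s hs2, hF₃ s hs3, e1, e2, traceMoment_eq_of_det_ne_zero hΘ 0 hh hdet hαβ]
      simp only [Nat.cast_zero, zero_mul, add_zero, mul_zero, sub_zero]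
    · -- order `e + 1`: the lower moments of orders `e` and `e - 1`, continued by the induction hypothesis at the same base point
      obtain ⟨G₁, hG₁d, hG₁⟩ := ih e a b
      obtain ⟨G₂, hG₂d, hG₂⟩ := ih (e - 1) a b
      have hc2 : ((e - 1 : ℕ) : ℝ) ≤ (e : ℝ) := by exact_mod_cast Nat.sub_le e 1
      have hsubG1 : {s : ℂ | 3 + ((e + 1 : ℕ) : ℝ) - ((N + 1 : ℕ) : ℝ) < (a + b + 2 * s).re} ⊆
          {s : ℂ | 3 + (e : ℝ) - (N : ℝ) < (a + b + 2 * s).re} := fun s hs => by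
        simp only [mem_setOf_eq, Nat.cast_add, Nat.cast_one] at hs ⊢
        linarith
      have hsubG2 : {s : ℂ | 3 + ((e + 1 : ℕ) : ℝ) - ((N + 1 : ℕ) : ℝ) < (a + b + 2 * s).re} ⊆
          {s : ℂ | 3 + ((e - 1 : ℕ) : ℝ) - (N : ℝ) < (a + b + 2 * s).re} := fun s hs => by
        simp only [mem_setOf_eq, Nat.cast_add, Nat.cast_one] at hs ⊢
        linarith
      have hlow : DifferentiableOn ℂ (fun s : ℂ => (h.det)⁻¹ * (((e + 1 : ℕ) : ℂ) * (h.adjugate * Θ).trace * G₁ s +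
          ((e + 1 : ℕ) : ℂ) * (((e + 1 : ℕ) : ℂ) - 1) * Θ.det * G₂ s))
          {s : ℂ | 3 + ((e + 1 : ℕ) : ℝ) - ((N + 1 : ℕ) : ℝ) < (a + b + 2 * s).re} :=
        (differentiableOn_const _).mul (((differentiableOn_const _).mul (hG₁d.mono hsubG1)).add
          ((differentiableOn_const _).mul (hG₂d.mono hsubG2)))
      refine ⟨fun s => (-(4 * (Real.pi : ℂ) ^ 2) * h.det)⁻¹ *
          ((a + s + (b + s) - 1) * ((a + s) * F₁ s + (b + s) * F₂ s) + 4 * (a + s) * (b + s) * F₃ s) -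
          (h.det)⁻¹ * (((e + 1 : ℕ) : ℂ) * (h.adjugate * Θ).trace * G₁ s + ((e + 1 : ℕ) : ℂ) * (((e + 1 : ℕ) : ℂ) - 1) * Θ.det * G₂ s),
        hmain.sub hlow, fun s hs => ?_⟩
      obtain ⟨hs1, hs2, hs3, hαβ⟩ := hconv s hs
      have hsG1 : 3 + (e : ℝ) < (a + b + 2 * s).re := by push_cast at hs; linarith
      have hsG2 : 3 + ((e - 1 : ℕ) : ℝ) < (a + b + 2 * s).re := by linarith
      have hrec := traceMoment_eq_of_det_ne_zero hΘ (e + 1) hh hdet hαβ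
      have i1 : e + 1 - 1 = e := by omega
      have i2 : e + 1 - 2 = e - 1 := by omega
      rw [i1, i2] at hrec
      simp only
      rw [hF₁ s hs1, hF₂ s hs2, hF₃ s hs3, hG₁ s hsG1, hG₂ s hsG2, e1, e2]
      exact hrec.symm

/-- The same continuation on ANY right half-plane `{c < re s}` (`N := ⌈3 + e − re(a+b) − 2c⌉₊`). -/
theorem exists_continuation_traceMoment_halfPlane {h Θ : Matrix (Fin 2) (Fin 2) ℂ} (hh : h.IsHermitian) (hdet : h.det ≠ 0) (hΘ : Θ.IsHermitian)
    (e : ℕ) (a b : ℂ) (c : ℝ) :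
    ∃ F : ℂ → ℂ, DifferentiableOn ℂ F {s : ℂ | c < s.re} ∧
      ∀ s : ℂ, 3 + (e : ℝ) < (a + b + 2 * s).re →
        F s = ∫ c : ℝ × ℂ × ℝ, (-(2 * Real.pi * I) * (Θ * hermTwo c).trace) ^ e * xiTwoIntegrand 1 h (a + s) (b + s) c := by
  obtain ⟨F, hFd, hF⟩ := exists_continuation_traceMoment hh hdet hΘ ⌈3 + (e : ℝ) - (a + b).re - 2 * c⌉₊ e a b
  refine ⟨F, hFd.mono fun s hs => ?_, hF⟩
  have hceil : 3 + (e : ℝ) - (a + b).re - 2 * c ≤ (⌈3 + (e : ℝ) - (a + b).re - 2 * c⌉₊ : ℝ) := Nat.le_ceil _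
  simp only [mem_setOf_eq, add_re, two_mul] at hs hceil ⊢
  linarith

/-! ## §2 The residual letter `hJet` of the consumer head, BY NAME -/

/-- **THE JET-CONTINUATION LETTER `hJet` OF ★ `K2LiuKindWArchIndefiniteLetter`, PAID** (organ «Φ6b-ind», all orders): for `h` hermitian with `det h < 0`,
`Θ` hermitian, every `e : ℕ` and `a b : ℂ`, the `e`-th real `h`-line jet `s ↦ (d∕dt)^e ξ(1, h + tΘ; a + s, b + s)|₀` continues holomorphically to
`{0 < re s}` (★ `iteratedDeriv_xiTwo_hLine` + §1). [cite: Shimura1982, §4 Thm. 4.2] [cite: Shimura1997, §16.5] -/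
theorem hJet_holds : ∀ (h Θ : Matrix (Fin 2) (Fin 2) ℂ), hᴴ = h → h.det.re < 0 → Θᴴ = Θ → ∀ (e : ℕ) (a b : ℂ),
    ∃ (F : ℂ → ℂ) (s₀ : ℝ), DifferentiableOn ℂ F {s : ℂ | 0 < s.re} ∧
      ∀ s : ℂ, s₀ < s.re → F s = iteratedDeriv e (fun t : ℝ => xiTwo 1 (h + (t : ℂ) • Θ) (a + s) (b + s)) 0 := by
  intro h Θ hherm hind hΘ e a b
  have hdet : h.det ≠ 0 := fun h0 => by rw [h0, Complex.zero_re] at hind; exact lt_irrefl _ hind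
  obtain ⟨F, hFd, hF⟩ := exists_continuation_traceMoment_halfPlane hherm hdet hΘ e a b 0
  refine ⟨F, (3 + (e : ℝ) - (a + b).re) / 2, hFd, fun s hs => ?_⟩
  have hs' : 3 + (e : ℝ) < (a + b + 2 * s).re := by simp only [add_re, two_mul] at hs ⊢; linarith
  have hαβ : 3 + (e : ℝ) < (a + s + (b + s)).re := by
    have e0 : (a + s + (b + s)).re = (a + b + 2 * s).re := by congr 1; ring
    rw [e0]; exact hs'
  rw [hF s hs', iteratedDeriv_xiTwo_hLine hherm hΘ e hαβ 0]
  simp only [ofReal_zero, zero_smul, add_zero]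

/-! ## §3 The indefinite head and the dispatch, UNCONDITIONAL -/

/-- **THE PER-PLACE ARCHIMEDEAN WHITTAKER LETTER AT AN INDEFINITE FRAMED INDEX, NO RESIDUAL LETTER** — the `hInd` telescope of ★
`K2LiuKindWArchWhittakerLetterDispatch.hW_of_signCases` BY NAME (★ head `exists_twistedWhittaker_continuation_of_indef` fed `hJet_holds`); the tie writes
`hInd := exists_twistedWhittaker_continuation_of_indef'`. [cite: Shimura1997, §16.4, §18.4] [cite: Shimura1982, §4 Thm. 4.2] -/
theorem exists_twistedWhittaker_continuation_of_indef' (k : ℤ) (hk : -2 ≤ k) (Q : Carrier) (B C : Matrix (Fin 2) (Fin 2) ℂ)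
    (hx : (fromBlocks 0 B C 0 : Matrix (Fin 2 ⊕ Fin 2) (Fin 2 ⊕ Fin 2) ℂ)ᴴ * Matrix.J (Fin 2) ℂ * (fromBlocks 0 B C 0 : Matrix (Fin 2 ⊕ Fin 2) (Fin 2 ⊕ Fin 2) ℂ) =
      Matrix.J (Fin 2) ℂ)
    (g : Matrix (Fin 2 ⊕ Fin 2) (Fin 2 ⊕ Fin 2) ℂ) (hg : gᴴ * Matrix.J (Fin 2) ℂ * g = Matrix.J (Fin 2) ℂ)
    (hidx : Matrix (Fin 2) (Fin 2) ℂ) (hherm : hidxᴴ = hidx) (hind : hidx.det.re < 0)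
    (eb : Matrix (Fin 2) (Fin 2) ℂ → ℂ) (heb : ∀ b, eb b = cexp (-(2 * Real.pi * I) * (hidx * b).trace))
    (hKpic : ∀ k₀ : Matrix (Fin 2 ⊕ Fin 2) (Fin 2 ⊕ Fin 2) ℂ, k₀ᴴ * Matrix.J (Fin 2) ℂ * k₀ = Matrix.J (Fin 2) ℂ →
      moeb k₀ (I • (1 : Matrix (Fin 2) (Fin 2) ℂ)) = I • 1 →
      ∃ P : MvPolynomial (((Fin 2 ⊕ Fin 2) × (Fin 2 ⊕ Fin 2)) ⊕ ((Fin 2 ⊕ Fin 2) × (Fin 2 ⊕ Fin 2))) ℂ,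
        ∀ (s : ℂ) (F : Matrix (Fin 2 ⊕ Fin 2) (Fin 2 ⊕ Fin 2) ℂ → ℂ), IsArchSiegelSection (fun z : ℂ => (conj z / ((‖z‖ : ℝ) : ℂ)) ^ k) s F →
          (∀ (v : Matrix (Fin 2) (Fin 2) ℂ), vᴴ * v = 1 → ∀ hv : v.det ≠ 0,
            F ((2 : ℂ)⁻¹ • fromBlocks (1 + v) (-(I • (1 - v))) (I • (1 - v)) (1 + v) : Matrix (Fin 2 ⊕ Fin 2) (Fin 2 ⊕ Fin 2) ℂ) = evalAt v hv Q) →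
          ∀ u : Matrix (Fin 2 ⊕ Fin 2) (Fin 2 ⊕ Fin 2) ℂ, uᴴ * Matrix.J (Fin 2) ℂ * u = Matrix.J (Fin 2) ℂ → moeb u (I • (1 : Matrix (Fin 2) (Fin 2) ℂ)) = I • 1 →
            F (u * k₀) = MvPolynomial.eval (Sum.elim (fun pq => u pq.1 pq.2) (fun pq => conj (u pq.1 pq.2))) P) :
    ∃ (Ew : ℂ → ℂ) (s₀ : ℝ), DifferentiableOn ℂ Ew {s : ℂ | 0 < s.re} ∧ ∀ s : ℂ, s₀ < s.re →
      ∀ F : Matrix (Fin 2 ⊕ Fin 2) (Fin 2 ⊕ Fin 2) ℂ → ℂ, IsArchSiegelSection (fun z : ℂ => (conj z / ((‖z‖ : ℝ) : ℂ)) ^ k) s F →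
        (∀ (v : Matrix (Fin 2) (Fin 2) ℂ), vᴴ * v = 1 → ∀ hv : v.det ≠ 0,
          F ((2 : ℂ)⁻¹ • fromBlocks (1 + v) (-(I • (1 - v))) (I • (1 - v)) (1 + v) : Matrix (Fin 2 ⊕ Fin 2) (Fin 2 ⊕ Fin 2) ℂ) = evalAt v hv Q) →
        ∫ r : Fin 2 → Fin 2 → ℝ, F ((fromBlocks 0 B C 0 : Matrix (Fin 2 ⊕ Fin 2) (Fin 2 ⊕ Fin 2) ℂ) * fromBlocks 1 (hermOfReal r) 0 1 * g) * eb (hermOfReal r) =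
          Ew s :=
  exists_twistedWhittaker_continuation_of_indef hJet_holds k hk Q B C hx g hg hidx hherm hind eb heb hKpic

/-- **THE PER-PLACE ARCHIMEDEAN WHITTAKER LETTER `hW` BY SIGN CASES, THE INDEFINITE SLOT DISCHARGED** — ★ `K2LiuKindWArchWhittakerLetterDispatch.hW_of_signCases`
with `hInd := exists_twistedWhittaker_continuation_of_indef hJet_holds`, every other binder and the conclusion VERBATIM: the letter `hW` at EVERY non-degenerate framed
index rests on the two ★ definite heads, this organ, the window `hk`, the frame ∕ index readings and the holomorphy letter `hWhol` (★ `hWhol_of_std`) — NO indefinite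
residual letter. [cite: Shimura1997, §16.4, §18.4] [cite: Shimura1982, §4 Thm. 4.2] -/
theorem hW_of_signCases' {ιS ιh W : Type*} (good : ιS → Prop) (k : W → ℤ) (hk : ∀ w, -2 ≤ k w)
    (B C : W → Matrix (Fin 2) (Fin 2) ℂ)
    (hx : ∀ w, (fromBlocks 0 (B w) (C w) 0 : Matrix (Fin 2 ⊕ Fin 2) (Fin 2 ⊕ Fin 2) ℂ)ᴴ * Matrix.J (Fin 2) ℂ *
      (fromBlocks 0 (B w) (C w) 0 : Matrix (Fin 2 ⊕ Fin 2) (Fin 2 ⊕ Fin 2) ℂ) = Matrix.J (Fin 2) ℂ)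
    (Pt : ιS → ιh → W → Matrix (Fin 2 ⊕ Fin 2) (Fin 2 ⊕ Fin 2) ℂ) (hPt : ∀ S h w, (Pt S h w)ᴴ * Matrix.J (Fin 2) ℂ * Pt S h w = Matrix.J (Fin 2) ℂ)
    (eb : ιS → ιh → W → Matrix (Fin 2) (Fin 2) ℂ → ℂ) (hidx : ιS → ιh → W → Matrix (Fin 2) (Fin 2) ℂ)
    (hherm : ∀ S h w, (hidx S h w)ᴴ = hidx S h w) (hdet : ∀ S, good S → ∀ h w, (hidx S h w).det ≠ 0)
    (hebr : ∀ S h w (b : Matrix (Fin 2) (Fin 2) ℂ), eb S h w b = cexp (-(2 * Real.pi * I) * (hidx S h w * b).trace))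
    (s₁ : ℝ) (hs₁ : 0 ≤ s₁)
    (hWhol : ∀ (S : ιS), good S → ∀ (h : ιh) (w : W) (Q : Carrier), ∀ s' : ℂ, s₁ < s'.re → ∀ F₀ : Matrix (Fin 2 ⊕ Fin 2) (Fin 2 ⊕ Fin 2) ℂ → ℂ,
      IsArchSiegelSection (fun z : ℂ => (conj z / ((‖z‖ : ℝ) : ℂ)) ^ (k w)) s' F₀ →
      (∀ (v : Matrix (Fin 2) (Fin 2) ℂ), vᴴ * v = 1 → ∀ hv : v.det ≠ 0,
        F₀ ((2 : ℂ)⁻¹ • fromBlocks (1 + v) (-(I • (1 - v))) (I • (1 - v)) (1 + v) : Matrix (Fin 2 ⊕ Fin 2) (Fin 2 ⊕ Fin 2) ℂ) = evalAt v hv Q) →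
      ∃ G : ℂ → Matrix (Fin 2 ⊕ Fin 2) (Fin 2 ⊕ Fin 2) ℂ → ℂ,
      (∀ s : ℂ, s₁ < s.re → IsArchSiegelSection (fun z : ℂ => (conj z / ((‖z‖ : ℝ) : ℂ)) ^ (k w)) s (G s)) ∧
      (∀ s : ℂ, s₁ < s.re → ∀ (v : Matrix (Fin 2) (Fin 2) ℂ), vᴴ * v = 1 → ∀ hv : v.det ≠ 0,
        G s ((2 : ℂ)⁻¹ • fromBlocks (1 + v) (-(I • (1 - v))) (I • (1 - v)) (1 + v) : Matrix (Fin 2 ⊕ Fin 2) (Fin 2 ⊕ Fin 2) ℂ) = evalAt v hv Q) ∧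
      DifferentiableOn ℂ (fun s : ℂ => ∫ r : Fin 2 → Fin 2 → ℝ,
        G s ((fromBlocks 0 (B w) (C w) 0 : Matrix (Fin 2 ⊕ Fin 2) (Fin 2 ⊕ Fin 2) ℂ) * fromBlocks 1 (hermOfReal r) 0 1 * Pt S h w) * eb S h w (hermOfReal r))
        {s : ℂ | s₁ < s.re}) :
    ∀ (S : ιS), good S → ∀ (h : ιh) (w : W) (Q : Carrier), ∃ Ew : ℂ → ℂ, DifferentiableOn ℂ Ew {s : ℂ | 0 < s.re} ∧ ∀ s : ℂ, s₁ < s.re →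
      ∀ F : Matrix (Fin 2 ⊕ Fin 2) (Fin 2 ⊕ Fin 2) ℂ → ℂ, IsArchSiegelSection (fun z : ℂ => (conj z / ((‖z‖ : ℝ) : ℂ)) ^ (k w)) s F →
        (∀ (v : Matrix (Fin 2) (Fin 2) ℂ), vᴴ * v = 1 → ∀ hv : v.det ≠ 0,
          F ((2 : ℂ)⁻¹ • fromBlocks (1 + v) (-(I • (1 - v))) (I • (1 - v)) (1 + v) : Matrix (Fin 2 ⊕ Fin 2) (Fin 2 ⊕ Fin 2) ℂ) = evalAt v hv Q) →
        ∫ x : Fin 2 → Fin 2 → ℝ, F ((fromBlocks 0 (B w) (C w) 0 : Matrix (Fin 2 ⊕ Fin 2) (Fin 2 ⊕ Fin 2) ℂ) * fromBlocks 1 (hermOfReal x) 0 1 * Pt S h w) *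
          eb S h w (hermOfReal x) = Ew s :=
  hW_of_signCases good k hk B C hx Pt hPt eb hidx hherm hdet hebr s₁ hs₁ hWhol (exists_twistedWhittaker_continuation_of_indef hJet_holds)

end Summit.HodgeConjecture.HodgeConjecture.Cruxes.HLiu418.K2LiuHermTwoXiJetContinuation

end
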